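import Summits.HodgeConjecture.CorCM.Census.CentralSquaresPartnersLawLocal

/-!
# The square-central class, LXV: the MIXED multi-partner law from far counts only (local ties)

COR-CM (cell `pub-hodgecm2`), count-neutral kernel combinatorics by the binder seat b09 (gen 50; lane SQUARE-CENTRAL CLASS, part LXV), on part LXIV
(`partner_families_of_far_counts`), part LX (`residual_closure_partners_indirect_bpot`), parts LI, LXI (`hbase_exchange_partners`, `card_sdiff_exchange_partners`,
`pair_exchange_partners`), part V (`cover_frame`) and part I (the strict cover-closure law), BY NAME.  Theorems only: no definition, no `decide`, no certificate, no
named fact, no `sorry`.  HONEST FRAMING: `HC_CM` is NOT proved, here or anywhere in the tree; nothing here is a period or a headline.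

**THE MIXED MULTI-PARTNER LAW FROM FAR COUNTS (`isLeast_card_gfaces_generate_partners_mixed_of_far_counts`)**: part LXIIʼs count form WITHOUT the global tie
counts — per direct partner (frame of `T₀`) and per indirect partner (frame of its direct partner `T₁`) only the swap, the two transversals and the four far
counts `3 … m−3` against every other partner are required.  This is the form the rank-two affine block of Pauli `× E` (`m ≥ 8`) satisfies: `T₁ = x₁`,
`T₃ = x₁ + x₃` direct, `T₂ = x₃` indirect via `T₁`, every count `m/2`.  Then **`μ(G, c) = φ₂(G, c)`**.

## References
* [Pohlmann1968] H. Pohlmann, Algebraic cycles on abelian varieties of complex multiplication type, Ann. of Math. 88 (1968), Thm 1.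
* [Milne1999] J. S. Milne, Lefschetz motives and the Tate conjecture, Compositio Math. 117 (1999), Prop. 2.1, p. 54.
-/

namespace Summit.HodgeConjecture.CorCM.Census.CentralSquares

open Finset
open scoped symmDiff
open Summit.HodgeConjecture.CorCM.Prior.AllgGroup.RfwfAllgGroup
open Summit.HodgeConjecture.CorCM.Census.BlockParity
open Summit.HodgeConjecture.CorCM.Census.Coinvariant
open Summit.HodgeConjecture.CorCM.Census.TwistGeneration
open Summit.HodgeConjecture.CorCM.Census.BaseBlock
open Summit.HodgeConjecture.CorCM.Census.CoverClosure

noncomputable section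

variable {G : Type*} [Group G] [Fintype G] [DecidableEq G] (c : G)

/-- **THE MIXED MULTI-PARTNER LAW FROM FAR COUNTS.**  Direct partners `𝒯 ≠ ∅` (dihedral from `T₀`) and indirect partners `𝒯'` (dihedral from a direct
partner), base block `{T₀, T̄₀} ∪ 𝒯 ∪ 𝒯' ∪` complements, `|T₀| = 4m`, `m ≥ 3`, all partner distances `2m`; per partner a swap, two transversals and the far
counts against every other partner (in the frame of `T₀`, resp. of the direct partner).  Then **`μ(G, c) = φ₂(G, c)`**. [folklore] -/
theorem isLeast_card_gfaces_generate_partners_mixed_of_far_counts (hG : IsPGroup 2 G) (hc2 : c * c = 1) (hc1 : c ≠ 1)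
    (hcen : ∀ x : G, x * c = c * x) (T₀ : CMF G c) (𝒯 𝒯' : Finset (CMF G c)) (h𝒯 : 𝒯.Nonempty)
    (hbase : ∀ Q : G, rt c Q T₀ = T₀ ∨ rt c Q T₀ = rt c c T₀ ∨ ∃ T₁ ∈ 𝒯 ∪ 𝒯', rt c Q T₀ = T₁ ∨ rt c Q T₀ = rt c c T₁)
    (m : ℕ) (hm : 3 ≤ m) (hn : T₀.1.card = 4 * m) (hH : ∀ T₁ ∈ 𝒯 ∪ 𝒯', (T₀.1 \ T₁.1).card = 2 * m)
    (hpair : ∀ T₁ ∈ 𝒯 ∪ 𝒯', ∀ T₂ ∈ 𝒯 ∪ 𝒯', T₁ ≠ T₂ → ((T₀.1 \ T₁.1) ∆ (T₀.1 \ T₂.1)).card = 2 * m)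
    (hframe : ∀ T₁ ∈ 𝒯, ∃ Q : G, ∃ T T' : Finset G,
      rt c Q T₀ = T₁ ∧ Q * Q = 1 ∧
      (∀ t ∈ T₀.1, ∀ t' ∈ T₀.1, (t' = t * Q ∨ t' = c * (t * Q)) → (t ∈ T₀.1 \ T₁.1 ↔ t' ∈ T₀.1 \ T₁.1)) ∧
      (T ⊆ T₀.1 \ T₁.1 ∧ T.card = m ∧ ∀ t ∈ T₀.1 \ T₁.1, ∀ t' ∈ T₀.1, (t' = t * Q ∨ t' = c * (t * Q)) → (t ∈ T ↔ t' ∉ T)) ∧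
      (T' ⊆ T₀.1 ∩ T₁.1 ∧ T'.card = m ∧ ∀ t ∈ T₀.1 ∩ T₁.1, ∀ t' ∈ T₀.1, (t' = t * Q ∨ t' = c * (t * Q)) → (t ∈ T' ↔ t' ∉ T')) ∧
      (∀ T₂ ∈ 𝒯 ∪ 𝒯', T₂ ≠ T₁ →
        (3 ≤ (T ∩ (T₀.1 \ T₂.1)).card ∧ (T ∩ (T₀.1 \ T₂.1)).card + 3 ≤ m) ∧
        (3 ≤ (((T₀.1 \ T₁.1) \ T).image (fun x => c * x) ∩ (T₁.1 \ T₂.1)).card ∧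
          (((T₀.1 \ T₁.1) \ T).image (fun x => c * x) ∩ (T₁.1 \ T₂.1)).card + 3 ≤ m) ∧
        (3 ≤ (T' ∩ (T₀.1 \ T₂.1)).card ∧ (T' ∩ (T₀.1 \ T₂.1)).card + 3 ≤ m) ∧
        (3 ≤ (((T₀.1 \ (rt c c T₁).1) \ T').image (fun x => c * x) ∩ ((rt c c T₁).1 \ T₂.1)).card ∧
          (((T₀.1 \ (rt c c T₁).1) \ T').image (fun x => c * x) ∩ ((rt c c T₁).1 \ T₂.1)).card + 3 ≤ m)))
    (hframe' : ∀ T₂ ∈ 𝒯', ∃ T₁ ∈ 𝒯, ∃ Q₁ Q : G, ∃ T T' : Finset G,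
      rt c Q₁ T₀ = T₁ ∧ rt c Q T₁ = T₂ ∧ Q * Q = 1 ∧
      (∀ t ∈ T₁.1, ∀ t' ∈ T₁.1, (t' = t * Q ∨ t' = c * (t * Q)) → (t ∈ T₁.1 \ T₂.1 ↔ t' ∈ T₁.1 \ T₂.1)) ∧
      (T ⊆ T₁.1 \ T₂.1 ∧ T.card = m ∧ ∀ t ∈ T₁.1 \ T₂.1, ∀ t' ∈ T₁.1, (t' = t * Q ∨ t' = c * (t * Q)) → (t ∈ T ↔ t' ∉ T)) ∧
      (T' ⊆ T₁.1 ∩ T₂.1 ∧ T'.card = m ∧ ∀ t ∈ T₁.1 ∩ T₂.1, ∀ t' ∈ T₁.1, (t' = t * Q ∨ t' = c * (t * Q)) → (t ∈ T' ↔ t' ∉ T')) ∧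
      (∀ T₃ ∈ insert T₀ ((𝒯 ∪ 𝒯').erase T₁), T₃ ≠ T₂ →
        (3 ≤ (T ∩ (T₁.1 \ T₃.1)).card ∧ (T ∩ (T₁.1 \ T₃.1)).card + 3 ≤ m) ∧
        (3 ≤ (((T₁.1 \ T₂.1) \ T).image (fun x => c * x) ∩ (T₂.1 \ T₃.1)).card ∧
          (((T₁.1 \ T₂.1) \ T).image (fun x => c * x) ∩ (T₂.1 \ T₃.1)).card + 3 ≤ m) ∧
        (3 ≤ (T' ∩ (T₁.1 \ T₃.1)).card ∧ (T' ∩ (T₁.1 \ T₃.1)).card + 3 ≤ m) ∧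
        (3 ≤ (((T₁.1 \ (rt c c T₂).1) \ T').image (fun x => c * x) ∩ ((rt c c T₂).1 \ T₃.1)).card ∧
          (((T₁.1 \ (rt c c T₂).1) \ T').image (fun x => c * x) ∩ ((rt c c T₂).1 \ T₃.1)).card + 3 ≤ m))) :
    IsLeast {n : ℕ | ∃ S : Finset (CMF G c →₀ ℤ), (↑S ⊆ gfaceSet G c hc2) ∧ S.card = n ∧
      hodgeSpan c hc2 ≤ Submodule.span ℤ (pairSet c) ⊔ Submodule.span ℤ (translates c S)} (fibreTwo c hc2) := by
  classical
  refine isLeast_card_gfaces_generate_of_strict_cover_closure c T₀ hG hc2 hc1 hcen (1 + 1) fun S hS hlow => ?_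
  have hP : ∀ Ψ : CMF G c, pair c Ψ ∈ Submodule.span ℤ (pairSet c) ⊔ Submodule.span ℤ (translates c S) :=
    fun Ψ => Submodule.mem_sup_left (Submodule.subset_span (pair_mem_pairSet c Ψ))
  have hLrt : ∀ (Q' : G) (y : CMF G c →₀ ℤ), y ∈ Submodule.span ℤ (pairSet c) ⊔ Submodule.span ℤ (translates c S) →
      Finsupp.mapDomain (rt c Q') y ∈ Submodule.span ℤ (pairSet c) ⊔ Submodule.span ℤ (translates c S) :=
    fun Q' y hy => mapDomain_rt_mem_psp c hcen Q' S hy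
  have hcover : ∀ Ψ : CMF G c, 2 ≤ bpot c T₀ Ψ → ∃ Q₂ s s' : G, bpot c T₀ Ψ = ddist (rt c Q₂ T₀) Ψ ∧
      s ∈ (rt c Q₂ T₀).1 \ Ψ.1 ∧ s' ∈ (rt c Q₂ T₀).1 \ Ψ.1 ∧ s ≠ s' ∧
      gface c hc2 Ψ s s' ∈ Submodule.span ℤ (pairSet c) ⊔ Submodule.span ℤ (translates c S) ∧
      ((∃ Q₁ t t' : G, bpot c T₀ Ψ = ddist (rt c Q₁ T₀) Ψ ∧ t ∈ (rt c Q₁ T₀).1 \ Ψ.1 ∧ t' ∈ (rt c Q₁ T₀).1 \ Ψ.1 ∧ t ≠ t' ∧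
          (∀ Q' : G, ddist (rt c Q' T₀) (oflipCM c hc2 t Ψ) = bpot c T₀ (oflipCM c hc2 t Ψ) → rt c Q' T₀ = rt c Q₁ T₀) ∧
          (∀ Q' : G, ddist (rt c Q' T₀) (oflipCM c hc2 t' Ψ) = bpot c T₀ (oflipCM c hc2 t' Ψ) → rt c Q' T₀ = rt c Q₁ T₀) ∧
          (∀ Q' : G, ddist (rt c Q' T₀) (oflipCM c hc2 t (oflipCM c hc2 t' Ψ)) = bpot c T₀ (oflipCM c hc2 t (oflipCM c hc2 t' Ψ)) →
            rt c Q' T₀ = rt c Q₁ T₀)) →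
        (∀ Q' : G, ddist (rt c Q' T₀) (oflipCM c hc2 s Ψ) = bpot c T₀ (oflipCM c hc2 s Ψ) → rt c Q' T₀ = rt c Q₂ T₀) ∧
        (∀ Q' : G, ddist (rt c Q' T₀) (oflipCM c hc2 s' Ψ) = bpot c T₀ (oflipCM c hc2 s' Ψ) → rt c Q' T₀ = rt c Q₂ T₀) ∧
        (∀ Q' : G, ddist (rt c Q' T₀) (oflipCM c hc2 s (oflipCM c hc2 s' Ψ)) = bpot c T₀ (oflipCM c hc2 s (oflipCM c hc2 s' Ψ)) →
          rt c Q' T₀ = rt c Q₂ T₀)) := fun Ψ h2 => by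
    obtain ⟨Q₂, s, s', hQ₂, hs, hs', hss', hmem, hstr⟩ := hlow Ψ h2
    exact ⟨Q₂, s, s', hQ₂, hs, hs', hss', Submodule.mem_sup_right hmem, hstr⟩
  have hHc : ∀ T₁ ∈ 𝒯 ∪ 𝒯', (T₀.1 ∩ T₁.1).card = 2 * m := by
    intro T₁ hT₁
    have h0 := card_sdiff_add_card_inter T₀.1 T₁.1
    have h1 := hH T₁ hT₁
    omega
  have h𝒯sub : ∀ T₁ ∈ 𝒯, T₁ ∈ 𝒯 ∪ 𝒯' := fun T₁ h => mem_union_left _ h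
  have hPF := fun T₁ (hT₁ : T₁ ∈ 𝒯) (Q : G) (T T' : Finset G) (hQ : rt c Q T₀ = T₁) (hQQ : Q * Q = 1) hσH hTH hTm hT hTH' hTm' hT' hcfar =>
    partner_families_of_far_counts c hc2 hcen T₀ (𝒯 ∪ 𝒯') hbase m hm hn hH hpair (h𝒯sub T₁ hT₁) Q hQ hQQ hσH T T' hTH hTm hT hTH' hTm' hT'
      hcfar _ hLrt hP hcover
  refine residual_closure_partners_indirect_bpot c hc2 hc1 hcen T₀ 𝒯 𝒯' h𝒯 hbase _ hP 1 m (fun T₁ h => hH T₁ (h𝒯sub T₁ h))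
    (fun T₁ h => hHc T₁ (h𝒯sub T₁ h)) ?_ ?_ ?_ ?_ ?_
  · intro T₁ hT₁ s hs
    obtain ⟨Q, T, T', hQ, hQQ, hσH, ⟨hTH, hTm, hT⟩, ⟨hTH', hTm', hT'⟩, hcfar⟩ := hframe T₁ hT₁
    rw [pow_one]; exact (hPF T₁ hT₁ Q T T' hQ hQQ hσH hTH hTm hT hTH' hTm' hT' hcfar).1 s hs
  · intro T₁ hT₁ a ha
    obtain ⟨Q, T, T', hQ, hQQ, hσH, ⟨hTH, hTm, hT⟩, ⟨hTH', hTm', hT'⟩, hcfar⟩ := hframe T₁ hT₁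
    rw [pow_one]; exact (hPF T₁ hT₁ Q T T' hQ hQQ hσH hTH hTm hT hTH' hTm' hT' hcfar).2.1 a ha
  · intro T₁ hT₁
    obtain ⟨Q, T, T', hQ, hQQ, hσH, ⟨hTH, hTm, hT⟩, ⟨hTH', hTm', hT'⟩, hcfar⟩ := hframe T₁ hT₁
    exact (hPF T₁ hT₁ Q T T' hQ hQQ hσH hTH hTm hT hTH' hTm' hT' hcfar).2.2.1
  · intro T₁ hT₁
    obtain ⟨Q, T, T', hQ, hQQ, hσH, ⟨hTH, hTm, hT⟩, ⟨hTH', hTm', hT'⟩, hcfar⟩ := hframe T₁ hT₁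
    exact (hPF T₁ hT₁ Q T T' hQ hQQ hσH hTH hTm hT hTH' hTm' hT' hcfar).2.2.2
  · intro T₂ hT₂
    obtain ⟨T₁, hT₁, Q₁, Q, T, T', hQ₁, hQ, hQQ, hσH, ⟨hTH, hTm, hT⟩, ⟨hTH', hTm', hT'⟩, hcfar⟩ := hframe' T₂ hT₂
    have hT₁u : T₁ ∈ 𝒯 ∪ 𝒯' := h𝒯sub T₁ hT₁
    have hbase₁ := hbase_exchange_partners c hbase hQ₁
    have hn₁ : T₁.1.card = 4 * m := card_frame c hc2 T₀ T₁ m hn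
    have hH₁ := card_sdiff_exchange_partners c hc2 T₀ (𝒯 ∪ 𝒯') m hH hpair hT₁u
    have hpair₁ := pair_exchange_partners c hc2 T₀ (𝒯 ∪ 𝒯') m hH hpair T₁
    have hcov₁ := cover_frame c hc2 T₀ (Submodule.span ℤ (pairSet c) ⊔ Submodule.span ℤ (translates c S)) Q₁ hcover
    simp only [hQ₁] at hcov₁
    have h12 : T₂ ≠ T₁ := by
      intro h; rw [h, Finset.sdiff_self] at hTH
      have h1 := card_le_card hTH; rw [card_empty] at h1; omega
    have hT₂' : T₂ ∈ insert T₀ ((𝒯 ∪ 𝒯').erase T₁) := mem_insert_of_mem (mem_erase.mpr ⟨h12, mem_union_right _ hT₂⟩)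
    have hH₁₂ : (T₁.1 \ T₂.1).card = 2 * m := hH₁ T₂ hT₂'
    have hHc₁₂ : (T₁.1 ∩ T₂.1).card = 2 * m := by
      have h0 := card_sdiff_add_card_inter T₁.1 T₂.1
      omega
    obtain ⟨f1, f2, f3, f4⟩ := partner_families_of_far_counts c hc2 hcen T₁ _ hbase₁ m hm hn₁ hH₁ hpair₁ hT₂' Q hQ hQQ hσH T T' hTH hTm hT hTH' hTm' hT'
      hcfar _ hLrt hP hcov₁
    refine ⟨T₁, hT₁, hH₁₂, hHc₁₂, ?_, ?_, f3, f4⟩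
    · intro s hs; rw [pow_one]; exact f1 s hs
    · intro a ha; rw [pow_one]; exact f2 a ha

end

end Summit.HodgeConjecture.CorCM.Census.CentralSquares
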